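import Summits.QuantumAdvantage.QuantumAdvantage.Theses.CubicForrelation
import Summits.QuantumAdvantage.QuantumAdvantage.Theorems.CubicForrelationNearExactIsExactBentDuality
import Summits.QuantumAdvantage.QuantumAdvantage.Theorems.CubicForrelationNearExactIsExactRmWeight
import Summits.QuantumAdvantage.QuantumAdvantage.Theorems.CubicForrelationNearExactIsExactDerivDegree
import Summits.QuantumAdvantage.QuantumAdvantage.Theorems.CubicForrelationNearExactIsExactTypeE8
import Summits.QuantumAdvantage.QuantumAdvantage.Theorems.CubicForrelationNearExactIsExactUniformRowDefect

/-!
# Crux `CubicForrelation.NearExactIsExact` (stmt-QuantumAdvantage-14043) — negative lemma: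
# codimension-2 flat surgery never improves a `15/16` bent function

B2b disprover gen 18 (habitat: Carlet flat modifications `g ⊕ 1_A` of the `15/16` core). HONEST FRAMING:
a THEOREM about the extremal landscape of cubic Forrelation (a no-go for one amplification mechanism),
NOT summit progress.

## Setting and results (all sorry-free, axioms ⊆ {propext, Classical.choice, Quot.sound})
`n = m + m`; `g` is bent with dual `d` (`W_g(x) = 2^m (−1)^{d(x)}`), and `d = K ⊕ F` with `deg K ≤ 3` and
`F` the indicator of a codimension-5 flat (`32·|F| = 2ⁿ`, every translate `F ⊕ t` equal to or disjoint
from `F`) — the shape of every known cubic pair with `Φ = 15/16` (`Negative/FifteenSixteenths.lean`;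
`Φ(f,g) = 1 − 2·dist(f,d)/2ⁿ` by `bb_forrelation_eq_of_dual`). The CODIMENSION-2 SURGERY along
`A = {y : α·y = a₁, β·y = a₂}` is any `g'` with `g' y = g y ⊕ [α·y = a₁]·[β·y = a₂]` pointwise (hypothesis
`hg'`, the brackets read off the characters: `[twist α y = signOf a₁]`; degree stays `≤ 3`). No new
definitions: the file is theorems only.
* `sg_W_surgery`: `2·W_{g⊕1_A}(x) = W_g(x) − (−1)^{a₁}W_g(x⊕α) − (−1)^{a₂}W_g(x⊕β)
  − (−1)^{a₁+a₂}W_g(x⊕α⊕β)`.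
* `sg_dual` (Carlet's dual formula, codimension 2): if `g` and `g ⊕ 1_A` are bent with duals `d, d'` then
  at every `x`: `D_α D_β d(x) = 0` and `d'(x) = d(x) ⊕ c(x)` with the flip set
  `c = [D_α d = a₁]·[D_β d = a₂]`, which is `α`- and `β`-periodic (`sg_flip_shift_α/β`).
* `sg_codimTwo_no_improvement` — **the no-go theorem**: then `dist(d', RM(3,n)) ≥ 2ⁿ/32` (for every cubic
  `K'`, `2ⁿ ≤ 32·|d' ⊕ K'|`); hence (`sg_codimTwo_forrelation_le`) `Φ(f, g ⊕ 1_A) ≤ 15/16` for EVERY cubic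
  `f`: codimension-2 surgery can move the defect of a `15/16`-function but neither shrink nor remove it.
  Proof (Reed–Muller minimum weights only, no Kasami–Tokura): with `e' = d' ⊕ K'` light and `k = K ⊕ K'`
  cubic, `F = c ⊕ k ⊕ e'`. (1) `F` is `α`-periodic: else `F`, `F ⊕ α` are disjoint and `D_α F` has weight
  `2|F| = 2ⁿ/16`, while `D_α F = D_α k ⊕ D_α e'` with `deg D_α k ≤ 2` (`stub_derivDegree`): `D_α k = 0` gives
  `2|F| ≤ 2|e'| < 2|F|`, and `D_α k ≠ 0` weighs `≥ 2ⁿ/4 > 2|F| + 2|e'|` (`stub_rmWeight`). (2) So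
  `D_α d = D_α K`, `D_β d = D_β K` have degree `≤ 2` and `deg c ≤ 4` (`sg_isDegLeFun_and`). (3) The word
  `F ⊕ e' = c ⊕ k` has degree `≤ 4`, is nonzero (`|F| > |e'|`), weighs `< 2ⁿ/16`: contradicts `stub_rmWeight`.

## Context (informal, not formalised here)
Codimension-1 surgery translates the dual (trivial); for codimension 3 the same conclusion holds by a
longer argument through the Kasami–Tokura gap `(d, 3d/2)` of `RM(3,n)` — see, with the numerical census
(n = 16: all 1692 bent codimension-3 and all 320 bent coordinate codimension-2 surgeries of the `15/16` core
have `Φ_max ≤ 15/16`; n = 22: kit job j111772), `run/shared/lean/b2b/cubic-forrelation/DISPROOF.md` §25.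
Sources (orientation only; everything below is proved from the tree): C. Carlet, *Boolean Functions for
Cryptography and Coding Theory*, CUP 2021, §6.1.17 (bent functions modified on flats, after Dillon 1974 and
Carlet, EUROCRYPT '93, LNCS 765); MacWilliams–Sloane (1977) Ch. 13 Thm 3 (minimum weight of `RM(r,m)`,
here the landed `stub_rmWeight ∘ stub_derivDegree`).
-/

set_option linter.dupNamespace false -- D-0017: single-problem summit

namespace Summit.QuantumAdvantage.QuantumAdvantage.Theorems.NearExactIsExact.Negative.SurgeryCodimTwo

open Finset
open Literature.Computability.QuantumComplexity
open Literature.Computability.QuantumComplexity.BuzetChailloux (bxor bxor_comm bxor_bxor_cancel_left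
  twist_bxor_right)
open Literature.Computability.QuantumComplexity.Simon (twist_eq_one_or)
open Literature.Computability.QuantumComplexity.DerivativeWalsh (W)
open Summit.QuantumAdvantage.QuantumAdvantage.Theorems.CubicForrelation.NearExactIsExact
  (stub_rmWeight stub_derivDegree rm_isDegLeFun_congr bb_isDegLeFun_bxor bb_forrelation_eq_of_dual
    te_isDegLeFun_band ur_bxor_cancel_right)

variable {n : ℕ}

/-! ### Bit-vector and counting helpers -/

/-- `(x ⊕ s) ⊕ t = (x ⊕ t) ⊕ s`. -/
theorem sg_bxor_right_comm (x s t : Fin n → Bool) : bxor (bxor x s) t = bxor (bxor x t) s := by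
  funext i
  show ((x i ^^ s i) ^^ t i) = ((x i ^^ t i) ^^ s i)
  cases x i <;> cases s i <;> cases t i <;> rfl

/-- A shift does not change the weight. -/
theorem sg_card_shift (P : (Fin n → Bool) → Bool) (t : Fin n → Bool) :
    (univ.filter fun x => P (bxor x t) = true).card = (univ.filter fun x => P x = true).card := by
  refine card_nbij' (fun x => bxor x t) (fun x => bxor x t) ?_ ?_ ?_ ?_
  · intro x hx
    simp only [coe_filter, mem_univ, true_and, Set.mem_setOf_eq] at hx ⊢
    exact hx
  · intro x hx
    simp only [coe_filter, mem_univ, true_and, Set.mem_setOf_eq] at hx ⊢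
    rw [ur_bxor_cancel_right]; exact hx
  all_goals intro x _; exact ur_bxor_cancel_right x t

/-- `|R| ≤ |P| + |Q|` whenever `R = P ⊕ Q` pointwise. -/
theorem sg_card_le_of_xor (P Q R : (Fin n → Bool) → Bool) (h : ∀ x, R x = (P x ^^ Q x)) :
    (univ.filter fun x => R x = true).card ≤
      (univ.filter fun x => P x = true).card + (univ.filter fun x => Q x = true).card := by
  calc (univ.filter fun x => R x = true).card
      ≤ ((univ.filter fun x => P x = true) ∪ (univ.filter fun x => Q x = true)).card := by
        refine card_le_card fun x hx => ?_
        simp only [mem_filter, mem_univ, true_and, mem_union] at hx ⊢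
        rw [h x] at hx
        revert hx; cases P x <;> cases Q x <;> simp
    _ ≤ _ := card_union_le _ _

/-- The derivative of a word has at most twice its weight. -/
theorem sg_card_deriv_le (P : (Fin n → Bool) → Bool) (t : Fin n → Bool) :
    (univ.filter fun x => (P x ^^ P (bxor x t)) = true).card ≤
      (univ.filter fun x => P x = true).card + (univ.filter fun x => P x = true).card := by
  have h := sg_card_le_of_xor P (fun x => P (bxor x t)) (fun x => P x ^^ P (bxor x t)) fun _ => rfl
  rwa [sg_card_shift P t] at h

/-- If `P` and its translate `P ⊕ t` are disjoint, the derivative `D_t P` has exactly twice the weight. -/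
theorem sg_card_deriv_eq (P : (Fin n → Bool) → Bool) (t : Fin n → Bool)
    (hdisj : ∀ x, P x = true → P (bxor x t) = false) :
    (univ.filter fun x => (P x ^^ P (bxor x t)) = true).card =
      (univ.filter fun x => P x = true).card + (univ.filter fun x => P x = true).card := by
  have hset : (univ.filter fun x => (P x ^^ P (bxor x t)) = true) =
      (univ.filter fun x => P x = true) ∪ (univ.filter fun x => P (bxor x t) = true) := by
    ext x
    simp only [mem_filter, mem_univ, true_and, mem_union]
    have h1 := hdisj x
    revert h1; cases P x <;> cases P (bxor x t) <;> simp
  have hdis : Disjoint (univ.filter fun x => P x = true) (univ.filter fun x => P (bxor x t) = true) := by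
    rw [disjoint_filter]
    intro x _ h1 h2
    rw [hdisj x h1] at h2
    exact Bool.false_ne_true h2
  rw [hset, card_union_of_disjoint hdis, sg_card_shift P t]

/-- If `|Q| < |P|` there is a point of `P` outside `Q`. -/
theorem sg_exists_true_false (P Q : (Fin n → Bool) → Bool)
    (h : (univ.filter fun x => Q x = true).card < (univ.filter fun x => P x = true).card) :
    ∃ x, P x = true ∧ Q x = false := by
  by_contra hne; push Not at hne
  refine absurd (card_le_card fun x hx => ?_) (not_le.2 h)
  simp only [mem_filter, mem_univ, true_and] at hx ⊢
  have := hne x hx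
  revert this; cases Q x <;> simp

/-- `x ↦ ¬(h x ⊕ a)` has the degree of `h`. -/
theorem sg_isDegLeFun_not_xor_const {d₀ : ℕ} {h : (Fin n → Bool) → Bool} (hh : IsDegLeFun d₀ h)
    (a : Bool) : IsDegLeFun d₀ (fun x => !(h x ^^ a)) :=
  rm_isDegLeFun_congr (bb_isDegLeFun_bxor hh (isDegLeFun_const d₀ (!a))) fun x => by
    cases h x <;> cases a <;> rfl

/-! ### The Walsh transform of a codimension-2 surgery -/

/-- Sign of the surgery: `(−1)^{g ⊕ 1_A} = (−1)^g · (1 − 2·1_A)` with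
`1_A(y) = (1 + (−1)^{a₁}(−1)^{α·y})(1 + (−1)^{a₂}(−1)^{β·y})/4`. -/
theorem sg_signOf_surgery (g : (Fin n → Bool) → Bool) (α β : Fin n → Bool) (a₁ a₂ : Bool)
    (y : Fin n → Bool) :
    signOf (g y ^^ (decide (twist α y = signOf a₁) && decide (twist β y = signOf a₂))) =
      signOf (g y) * (1 - (1 + signOf a₁ * twist α y) * (1 + signOf a₂ * twist β y) / 2) := by
  rcases twist_eq_one_or α y with h₁ | h₁ <;> rcases twist_eq_one_or β y with h₂ | h₂ <;>
    cases a₁ <;> cases a₂ <;> cases g y <;> simp [h₁, h₂, signOf] <;> norm_num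

/-- **Walsh transform of a codimension-2 surgery** `g' = g ⊕ 1_A` (expand `1_A` into characters, shift):
`2 W_{g'}(x) = W_g(x) − (−1)^{a₁}W_g(x⊕α) − (−1)^{a₂}W_g(x⊕β) − (−1)^{a₁+a₂}W_g(x⊕α⊕β)`. -/
theorem sg_W_surgery {g g' : (Fin n → Bool) → Bool} {α β : Fin n → Bool} {a₁ a₂ : Bool}
    (hg' : ∀ y, g' y = (g y ^^ (decide (twist α y = signOf a₁) && decide (twist β y = signOf a₂))))
    (x : Fin n → Bool) :
    W (fun y => signOf (g' y)) x =
      (W (fun y => signOf (g y)) x - signOf a₁ * W (fun y => signOf (g y)) (bxor x α)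
        - signOf a₂ * W (fun y => signOf (g y)) (bxor x β)
        - signOf a₁ * signOf a₂ * W (fun y => signOf (g y)) (bxor (bxor x α) β)) / 2 := by
  have key : ∀ y : Fin n → Bool, signOf (g' y) * twist y x =
      (signOf (g y) * twist y x - signOf a₁ * (signOf (g y) * twist y (bxor x α))
        - signOf a₂ * (signOf (g y) * twist y (bxor x β))
        - signOf a₁ * signOf a₂ * (signOf (g y) * twist y (bxor (bxor x α) β))) / 2 := by
    intro y
    rw [hg' y, sg_signOf_surgery, twist_bxor_right y (bxor x α) β, twist_bxor_right y x α,
      twist_bxor_right y x β, twist_comm y α, twist_comm y β]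
    ring
  unfold W
  simp_rw [key]
  rw [← sum_div, sum_sub_distrib, sum_sub_distrib, sum_sub_distrib, ← mul_sum, ← mul_sum, ← mul_sum]

/-! ### Carlet's dual formula for a bent surgery -/

/-- The 128-case sign lemma behind `sg_dual`: the sign equation forces the coset of `x` to have even
`d`-parity and identifies the new dual bit. -/
theorem sg_sign_cases (p q r t a₁ a₂ p' : Bool)
    (h : signOf p' = (signOf p - signOf a₁ * signOf q - signOf a₂ * signOf r
        - signOf a₁ * signOf a₂ * signOf t) / 2) :
    (p ^^ q ^^ r ^^ t) = false ∧ p' = (p ^^ (!(p ^^ q ^^ a₁) && !(p ^^ r ^^ a₂))) := by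
  revert h
  cases p <;> cases q <;> cases r <;> cases t <;> cases a₁ <;> cases a₂ <;> cases p' <;>
    simp [signOf] <;> norm_num

/-- **Carlet's dual formula (codimension 2).** If `g` is bent with dual `d` and the surgery `g' = g ⊕ 1_A`
is bent with dual `d'`, then at every `x`: the second derivative `D_α D_β d(x)` vanishes, and
`d'(x) = d(x) ⊕ [D_α d(x) = a₁]·[D_β d(x) = a₂]`. -/
theorem sg_dual {m : ℕ} {g g' d d' : (Fin (m + m) → Bool) → Bool} {α β : Fin (m + m) → Bool}
    {a₁ a₂ : Bool}
    (hd : ∀ x, W (fun y => signOf (g y)) x = (2 : ℝ) ^ m * signOf (d x))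
    (hg' : ∀ y, g' y = (g y ^^ (decide (twist α y = signOf a₁) && decide (twist β y = signOf a₂))))
    (hd' : ∀ x, W (fun y => signOf (g' y)) x = (2 : ℝ) ^ m * signOf (d' x))
    (x : Fin (m + m) → Bool) :
    (d x ^^ d (bxor x α) ^^ d (bxor x β) ^^ d (bxor (bxor x α) β)) = false ∧
      d' x = (d x ^^ (!(d x ^^ d (bxor x α) ^^ a₁) && !(d x ^^ d (bxor x β) ^^ a₂))) := by
  have h := hd' x
  rw [sg_W_surgery hg', hd, hd, hd, hd] at h
  have h2 : (2 : ℝ) ^ m ≠ 0 := by positivity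
  have h' : (2 : ℝ) ^ m * signOf (d' x) = (2 : ℝ) ^ m *
      ((signOf (d x) - signOf a₁ * signOf (d (bxor x α)) - signOf a₂ * signOf (d (bxor x β))
        - signOf a₁ * signOf a₂ * signOf (d (bxor (bxor x α) β))) / 2) := by
    rw [← h]; ring
  exact sg_sign_cases _ _ _ _ _ _ _ (mul_left_cancel₀ h2 h')

/-- The flip set `c = [D_α d = a₁]·[D_β d = a₂]` is `α`-periodic (given the parity constraint of `sg_dual`). -/
theorem sg_flip_shift_α {d c : (Fin n → Bool) → Bool} {α β : Fin n → Bool} {a₁ a₂ : Bool}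
    (hc : ∀ x, c x = (!(d x ^^ d (bxor x α) ^^ a₁) && !(d x ^^ d (bxor x β) ^^ a₂)))
    (hpar : ∀ x, (d x ^^ d (bxor x α) ^^ d (bxor x β) ^^ d (bxor (bxor x α) β)) = false)
    (x : Fin n → Bool) : c (bxor x α) = c x := by
  rw [hc, hc, ur_bxor_cancel_right]
  have h := hpar x; revert h
  cases d x <;> cases d (bxor x α) <;> cases d (bxor x β) <;> cases d (bxor (bxor x α) β) <;>
    cases a₁ <;> cases a₂ <;> decide

/-- The flip set is `β`-periodic (given the parity constraint of `sg_dual`). -/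
theorem sg_flip_shift_β {d c : (Fin n → Bool) → Bool} {α β : Fin n → Bool} {a₁ a₂ : Bool}
    (hc : ∀ x, c x = (!(d x ^^ d (bxor x α) ^^ a₁) && !(d x ^^ d (bxor x β) ^^ a₂)))
    (hpar : ∀ x, (d x ^^ d (bxor x α) ^^ d (bxor x β) ^^ d (bxor (bxor x α) β)) = false)
    (x : Fin n → Bool) : c (bxor x β) = c x := by
  rw [hc, hc, ur_bxor_cancel_right, sg_bxor_right_comm x β α]
  have h := hpar x; revert h
  cases d x <;> cases d (bxor x α) <;> cases d (bxor x β) <;> cases d (bxor (bxor x α) β) <;>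
    cases a₁ <;> cases a₂ <;> decide

/-! ### The no-go theorem -/

/-- Step (1): the defect `F` is `t`-periodic along every direction `t` along which the flip set `c` is
periodic (given `F = c ⊕ k ⊕ e` with `k` cubic, `e` light, and "translate equal or disjoint" for `F`). -/
theorem sg_periodic {m : ℕ} {F k e c : (Fin (m + m) → Bool) → Bool} {t : Fin (m + m) → Bool}
    (hk : IsDegLeFun 3 k)
    (hFcard : 2 ^ 5 * (univ.filter fun x => F x = true).card = 2 ^ (m + m))
    (hFflat : (∀ x, F (bxor x t) = F x) ∨ (∀ x, F x = true → F (bxor x t) = false))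
    (he : 2 ^ 5 * (univ.filter fun x => e x = true).card < 2 ^ (m + m))
    (hc : ∀ x, c (bxor x t) = c x)
    (hF : ∀ x, F x = (c x ^^ k x ^^ e x)) :
    ∀ x, F (bxor x t) = F x := by
  rcases hFflat with h | hdisj
  · exact h
  exfalso
  -- the derivative of F along t is the xor of the derivatives of k and e (c cancels)
  have hDk : IsDegLeFun 2 (fun x => k x ^^ k (bxor x t)) := stub_derivDegree (m + m) 2 k t hk
  have hDF : ∀ x, (F x ^^ F (bxor x t)) = ((k x ^^ k (bxor x t)) ^^ (e x ^^ e (bxor x t))) := by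
    intro x
    rw [hF x, hF (bxor x t), hc x]
    cases c x <;> cases k x <;> cases k (bxor x t) <;> cases e x <;> cases e (bxor x t) <;> rfl
  have hwF := sg_card_deriv_eq F t hdisj
  have hwe := sg_card_deriv_le e t
  by_cases hz : ∃ x, (k x ^^ k (bxor x t)) = true
  · -- `D_t k ≠ 0` has weight ≥ 2ⁿ/4, but `D_t k = D_t F ⊕ D_t e` is light
    have hR := stub_rmWeight stub_derivDegree (m + m) 2 _ hDk hz
    have hle := sg_card_le_of_xor (fun x => F x ^^ F (bxor x t)) (fun x => e x ^^ e (bxor x t))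
      (fun x => k x ^^ k (bxor x t)) fun x => by
        rw [hDF x]
        cases (k x ^^ k (bxor x t)) <;> cases (e x ^^ e (bxor x t)) <;> rfl
    have h4 : 2 ^ (m + m) = 2 ^ 2 * 2 ^ (m + m - 2) := by
      rw [← pow_add]; congr 1
      have : 2 ≤ m + m := by
        by_contra hlt
        push Not at hlt
        have : 2 ^ (m + m) < 2 ^ 2 := Nat.pow_lt_pow_right (by norm_num) hlt
        omega
      omega
    omega
  · -- `D_t k = 0`: then `D_t F = D_t e`, too light
    push Not at hz
    have hle := sg_card_le_of_xor (fun x => e x ^^ e (bxor x t)) (fun _ => false)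
      (fun x => F x ^^ F (bxor x t)) fun x => by
        rw [hDF x, Bool.eq_false_iff.2 (hz x)]
        cases (e x ^^ e (bxor x t)) <;> rfl
    have h0 : (univ.filter fun x : Fin (m + m) → Bool => false = true).card = 0 := by simp
    omega

/-- **No-go for codimension-2 surgery on a `15/16` bent function.** Let `g` be bent on `m + m` bits with
dual `d = K ⊕ F`, `K` cubic, `F` (the defect) of weight `2ⁿ/32` with all translates equal or disjoint
(a codimension-5 flat). If the surgery `g' = g ⊕ 1_A`, `A = {α·y = a₁, β·y = a₂}`, is bent with dual
`d'`, then `d'` is at distance `≥ 2ⁿ/32` from every cubic: `2ⁿ ≤ 32·|d' ⊕ K'|`. -/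
theorem sg_codimTwo_no_improvement {m : ℕ} {g g' d K F d' : (Fin (m + m) → Bool) → Bool}
    {α β : Fin (m + m) → Bool} {a₁ a₂ : Bool}
    (hd : ∀ x, W (fun y => signOf (g y)) x = (2 : ℝ) ^ m * signOf (d x))
    (hdK : ∀ x, d x = (K x ^^ F x)) (hK : IsDegLeFun 3 K)
    (hFcard : 2 ^ 5 * (univ.filter fun x => F x = true).card = 2 ^ (m + m))
    (hFflat : ∀ t, (∀ x, F (bxor x t) = F x) ∨ (∀ x, F x = true → F (bxor x t) = false))
    (hg' : ∀ y, g' y = (g y ^^ (decide (twist α y = signOf a₁) && decide (twist β y = signOf a₂))))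
    (hd' : ∀ x, W (fun y => signOf (g' y)) x = (2 : ℝ) ^ m * signOf (d' x))
    (K' : (Fin (m + m) → Bool) → Bool) (hK' : IsDegLeFun 3 K') :
    2 ^ (m + m) ≤ 2 ^ 5 * (univ.filter fun x => (d' x ^^ K' x) = true).card := by
  by_contra hlt
  push Not at hlt
  -- notation: the light word e = d' ⊕ K', the cubic k = K ⊕ K', the flip set c
  obtain ⟨c, hc⟩ : ∃ c : (Fin (m + m) → Bool) → Bool,
      ∀ x, c x = (!(d x ^^ d (bxor x α) ^^ a₁) && !(d x ^^ d (bxor x β) ^^ a₂)) := ⟨_, fun _ => rfl⟩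
  have hk : IsDegLeFun 3 (fun x => K x ^^ K' x) := bb_isDegLeFun_bxor hK hK'
  have hpar := fun x => (sg_dual hd hg' hd' x).1
  have hF : ∀ x, F x = (c x ^^ (K x ^^ K' x) ^^ (d' x ^^ K' x)) := by
    intro x
    have h1 := (sg_dual hd hg' hd' x).2
    rw [← hc x, hdK x] at h1
    rw [h1]
    cases c x <;> cases K x <;> cases K' x <;> cases F x <;> rfl
  -- (1) F is α- and β-periodic
  have hFα : ∀ x, F (bxor x α) = F x :=
    sg_periodic hk hFcard (hFflat α) hlt (sg_flip_shift_α hc hpar) hF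
  have hFβ : ∀ x, F (bxor x β) = F x :=
    sg_periodic hk hFcard (hFflat β) hlt (sg_flip_shift_β hc hpar) hF
  -- (2) the flip set has degree ≤ 4
  have hDα : IsDegLeFun 2 (fun x => d x ^^ d (bxor x α)) :=
    rm_isDegLeFun_congr (stub_derivDegree (m + m) 2 K α hK) fun x => by
      rw [hdK x, hdK (bxor x α), hFα x]
      cases K x <;> cases K (bxor x α) <;> cases F x <;> rfl
  have hDβ : IsDegLeFun 2 (fun x => d x ^^ d (bxor x β)) :=
    rm_isDegLeFun_congr (stub_derivDegree (m + m) 2 K β hK) fun x => by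
      rw [hdK x, hdK (bxor x β), hFβ x]
      cases K x <;> cases K (bxor x β) <;> cases F x <;> rfl
  have hcdeg : IsDegLeFun 4 c :=
    rm_isDegLeFun_congr (te_isDegLeFun_band (sg_isDegLeFun_not_xor_const hDα a₁)
      (sg_isDegLeFun_not_xor_const hDβ a₂)) fun x => (hc x).symm
  -- (3) the word F ⊕ e = c ⊕ k has degree ≤ 4, is nonzero and light
  have hw : IsDegLeFun 4 (fun x => F x ^^ (d' x ^^ K' x)) :=
    rm_isDegLeFun_congr (bb_isDegLeFun_bxor hcdeg (hk.mono (by norm_num))) fun x => by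
      rw [hF x]
      cases c x <;> cases (K x ^^ K' x) <;> cases (d' x ^^ K' x) <;> rfl
  have hlt' : (univ.filter fun x => (d' x ^^ K' x) = true).card <
      (univ.filter fun x => F x = true).card := by
    omega
  obtain ⟨x₀, hx₀F, hx₀e⟩ := sg_exists_true_false F (fun x => d' x ^^ K' x) hlt'
  have hne : ∃ x, (F x ^^ (d' x ^^ K' x)) = true := ⟨x₀, by rw [hx₀F, hx₀e]; rfl⟩
  have hR := stub_rmWeight stub_derivDegree (m + m) 4 _ hw hne
  have hle := sg_card_le_of_xor F (fun x => d' x ^^ K' x) (fun x => F x ^^ (d' x ^^ K' x)) fun _ => rfl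
  have h16 : 2 ^ (m + m) = 2 ^ 4 * 2 ^ (m + m - 4) := by
    rw [← pow_add]; congr 1
    have : 5 ≤ m + m := by
      by_contra h5
      push Not at h5
      have : 2 ^ (m + m) < 2 ^ 5 := Nat.pow_lt_pow_right (by norm_num) h5
      omega
    omega
  omega

/-- **Corollary (forrelation form).** Under the same hypotheses, `Φ(f, g') ≤ 15/16` for every cubic `f`:
codimension-2 surgery on a `15/16` bent function never enters the window `(15/16, 1]`. -/
theorem sg_codimTwo_forrelation_le {m : ℕ} {g g' d K F d' : (Fin (m + m) → Bool) → Bool}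
    {α β : Fin (m + m) → Bool} {a₁ a₂ : Bool}
    (hd : ∀ x, W (fun y => signOf (g y)) x = (2 : ℝ) ^ m * signOf (d x))
    (hdK : ∀ x, d x = (K x ^^ F x)) (hK : IsDegLeFun 3 K)
    (hFcard : 2 ^ 5 * (univ.filter fun x => F x = true).card = 2 ^ (m + m))
    (hFflat : ∀ t, (∀ x, F (bxor x t) = F x) ∨ (∀ x, F x = true → F (bxor x t) = false))
    (hg' : ∀ y, g' y = (g y ^^ (decide (twist α y = signOf a₁) && decide (twist β y = signOf a₂))))
    (hd' : ∀ x, W (fun y => signOf (g' y)) x = (2 : ℝ) ^ m * signOf (d' x))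
    (f : (Fin (m + m) → Bool) → Bool) (hf : IsDegLeFun 3 f) :
    forrelation f g' ≤ 15 / 16 := by
  have hw := sg_codimTwo_no_improvement hd hdK hK hFcard hFflat hg' hd' f hf
  have hset : (univ.filter fun x => (d' x ^^ f x) = true) = univ.filter fun x => f x ≠ d' x := by
    refine filter_congr fun x _ => ?_
    cases f x <;> cases d' x <;> simp
  rw [hset] at hw
  have hw' : (2 : ℝ) ^ (m + m) ≤ 2 ^ 5 * ((univ.filter fun x => f x ≠ d' x).card : ℝ) := by
    exact_mod_cast hw
  rw [bb_forrelation_eq_of_dual f _ d' hd']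
  have h2 : (0 : ℝ) < (2 : ℝ) ^ (m + m) := by positivity
  rw [sub_le_iff_le_add, show (15 : ℝ) / 16 = 1 - 2 * ((2 : ℝ) ^ (m + m) / 2 ^ 5) / 2 ^ (m + m) by
    field_simp; ring]
  have : 2 * ((2 : ℝ) ^ (m + m) / 2 ^ 5) / 2 ^ (m + m) ≤
      2 * ((univ.filter fun x => f x ≠ d' x).card : ℝ) / 2 ^ (m + m) := by
    apply div_le_div_of_nonneg_right _ h2.le
    nlinarith
  linarith

end Summit.QuantumAdvantage.QuantumAdvantage.Theorems.NearExactIsExact.Negative.SurgeryCodimTwo
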